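/-
Copyright (c) 2026. All rights reserved.
Released under Apache 2.0 license as described in the file LICENSE.
Authors: abc-iut cell, F fact-proving wave seat abc-iut-f-073 (tranche 73, exact criterion for F-0319).
-/
import Literature.AnabelianGeometry.AbsoluteAnabelian.AbsTopIII.BiAnabelianObservableCells

/-!
# [AbsTopIII] Cor 3.7 (iii)/(iv): path combinatorics of the oriented graph `Γ⃗_{𝒟†_{≤3}}`

S. Mochizuki, *Topics in absolute anabelian geometry III* [MochizukiAbsTopIII2015] (kurims manuscript
`paper:url-5493eb38cbb7`; journal pagination not held), Cor 3.7 (iii)/(iv) p. 88.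

Technical companion of `BiAnabelianIncompatibility.lean` (abc-iut-L4-t9: the presentation
`logObsDiagram` of `𝒟†_{≤3}` = `𝒟†_{≤2}` extended by the observation vertex `𝒩`) and of
`BiAnabelianObservableCells.lean` (its first path lemmas), for the EXACT CRITERION of the schema row
F-0319 `IncompatibleStmt` (files `BiAnabelianIncompatibilityKernel{Shadow,Cells,Family}.lean`,
`BiAnabelianIncompatibilityCriterion.lean`).  Pure combinatorics of the graph (vertices `⋎ = n` of
row 1, `□`, `𝒩`; edges `log_𝒳`, `pr_⋎`, `λ^×`, `λ^{×pf}`), no functor involved: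

* `kerGood` — the vertices at which boundary pairs of the criterion's family may end (all but row 1),
  stable along paths (`kerGood_of_path`);
* `not_path_lvBox_first`, `path_lvBox_eq_nil` — no path leaves `□` except towards `𝒩`;
  `exists_eq_cons_of_path_lvObs` — a path into `𝒩` is a path to `□` followed by `λ^×` or `λ^{×pf}`;
* `pfNum` — the number of `λ^{×pf}`-edges of a path (additive, `pfNum_comp`; zero off `𝒩`,
  `pfNum_eq_zero_of_ne_lvObs`), the invariant separating the two sides of the `ι_×` cells.

The vertices `space`, `galois`, `ref` of `Γ⃗_{𝒟*}` carry no `𝒟†_{≤2}`-structure (their membership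
proofs are contradictory); they are dispatched by `absurd` throughout.  Nothing here bears on
[IUTchIII] Cor. 3.12; no claim of the paper is asserted.
-/

set_option autoImplicit false

namespace Literature.AnabelianGeometry.AbsoluteAnabelian.AbsTopIII

open CategoryTheory Quiver DiagramOfCategories

universe u

namespace BiAnabelianSetting

section Paths

/-! ### Admissible terminal vertices -/

/-- Admissible terminal vertices: all but those of row 1 (no boundary pair of the family ends on
row 1). [cite: MochizukiAbsTopIII2015, Cor 3.7 (iv) p.88] -/
def kerGood : logObsShape.{u}.Vertex → Prop
  | .base ⟨.first _, _⟩ => False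
  | .base ⟨.box, _⟩ => True
  | .base ⟨.space, _⟩ => True
  | .base ⟨.galois, _⟩ => True
  | .base ⟨.ref, _⟩ => True
  | .obs => True

/-- `kerGood □`. [cite: MochizukiAbsTopIII2015, Cor 3.7 (iv) p.88] -/
theorem kerGood_lvBox : kerGood lvBox.{u} := trivial

/-- `kerGood 𝒩`. [cite: MochizukiAbsTopIII2015, Cor 3.7 (iv) p.88] -/
theorem kerGood_lvObs : kerGood lvObs.{u} := trivial

/-- `□ ≠ 𝒩` as vertices of `Γ⃗_{𝒟†_{≤3}}`. [cite: MochizukiAbsTopIII2015, Cor 3.7 (iii) p.88] -/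
theorem lvBox_ne_lvObs : lvBox.{u} ≠ lvObs.{u} := by
  intro h
  simp only [lvBox, lvObs, ExtShape.base, ExtShape.obs] at h
  cases h

/-- No vertex of row 1 is `□`. [cite: MochizukiAbsTopIII2015, Cor 3.7 (iii) p.88] -/
theorem base_first_ne_lvBox (n : ℤ) (h : (Cor37Vertex.first n).InDaggerLe 2) :
    logObsShape.{u}.base ⟨.first n, h⟩ ≠ lvBox.{u} := by
  intro e
  simp only [lvBox, ExtShape.base, dv] at e
  injection e with e
  injection e with e
  injection e

/-- There is no path from `□` to a vertex of row 1 (edges out of `□` go to `𝒩`).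
[cite: MochizukiAbsTopIII2015, Cor 3.7 (iii) p.88] -/
theorem not_path_lvBox_first : ∀ {b : logObsShape.{u}.Vertex} (p : Path lvBox.{u} b) (n : ℤ)
    (h : (Cor37Vertex.first n).InDaggerLe 2), b ≠ logObsShape.{u}.base ⟨.first n, h⟩ := by
  intro b p
  induction p with
  | nil => intro n h e; exact base_first_ne_lvBox n h e.symm
  | cons p e ih =>
    rename_i c d
    intro n h hd
    subst hd
    cases c with
    | obs => exact (PEmpty.elim e : _)
    | base c =>
      obtain ⟨c, hc⟩ := c
      cases c with
      | first m => exact ih m hc rfl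
      | box => cases e
      | space => cases e
      | galois => cases e
      | ref => exact absurd rfl hc.1

/-- The only path from `□` to `□` is the empty one. [cite: MochizukiAbsTopIII2015, Cor 3.7 (iii) p.88] -/
theorem path_lvBox_eq_nil : ∀ {b : logObsShape.{u}.Vertex} (p : Path lvBox.{u} b)
    (h : Cor37Vertex.box.InDaggerLe 2) (hb : b = logObsShape.{u}.base ⟨.box, h⟩), hb ▸ p = Path.nil := by
  intro b p
  cases p with
  | nil => intro h hb; cases hb; rfl
  | cons p e =>
    rename_i c
    intro h hb
    subst hb
    cases c with
    | obs => exact (PEmpty.elim e : _)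
    | base c =>
      obtain ⟨c, hc⟩ := c
      cases c with
      | first m => exact absurd rfl (not_path_lvBox_first p m hc)
      | box => cases e
      | space => cases e
      | galois => cases e
      | ref => exact absurd rfl hc.1

/-- A path into `𝒩` from another vertex is a path to `□` followed by `λ^×` or `λ^{×pf}`.
[cite: MochizukiAbsTopIII2015, Cor 3.7 (iii) p.88] -/
theorem exists_eq_cons_of_path_lvObs {a : logObsShape.{u}.Vertex} (p : Path a lvObs.{u})
    (ha : a ≠ lvObs.{u}) :
    ∃ (p₀ : Path a lvBox.{u}) (b : Bool), p = p₀.cons (ULift.up b : lvBox.{u} ⟶ lvObs.{u}) := by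
  cases p with
  | nil => exact absurd rfl ha
  | cons p e =>
    rename_i c
    cases c with
    | obs => exact (PEmpty.elim e : _)
    | base c =>
      obtain ⟨c, hc⟩ := c
      cases c with
      | box => exact ⟨p, e.down, rfl⟩
      | first _ => exact (PEmpty.elim e : _)
      | space => exact (PEmpty.elim e : _)
      | galois => exact (PEmpty.elim e : _)
      | ref => exact (PEmpty.elim e : _)

/-- A vertex with a path to `□` is not `𝒩`. [cite: MochizukiAbsTopIII2015, Cor 3.7 (iii) p.88] -/
theorem ne_lvObs_of_path_lvBox {a : logObsShape.{u}.Vertex} (p : Path a lvBox.{u}) : a ≠ lvObs.{u} := by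
  rintro rfl
  obtain ⟨e, -⟩ := path_from_lvObs p
  exact lvBox_ne_lvObs e

/-- Admissibility propagates along paths (no edge from an admissible vertex enters row 1).
[cite: MochizukiAbsTopIII2015, Cor 3.7 (iv) p.88] -/
theorem kerGood_of_path {b : logObsShape.{u}.Vertex} :
    ∀ {c : logObsShape.{u}.Vertex} (r : Path b c), kerGood b → kerGood c := by
  intro c r
  induction r with
  | nil => exact id
  | cons r e ih =>
    rename_i c d
    intro hb
    have hc := ih hb
    cases d with
    | obs => trivial
    | base d =>
      obtain ⟨d, hd⟩ := d
      cases d with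
      | first n =>
        cases c with
        | obs => exact (PEmpty.elim e : _)
        | base c =>
          obtain ⟨c, hc'⟩ := c
          cases c with
          | first m => exact hc.elim
          | box => cases e
          | space => cases e
          | galois => cases e
          | ref => exact absurd rfl hc'.1
      | box => trivial
      | space => trivial
      | galois => trivial
      | ref => trivial

/-! ### The number of `λ^{×pf}`-edges of a path -/

/-- `1` on the observation edge `λ^{×pf}`, `0` on `λ^×`. [cite: MochizukiAbsTopIII2015, Cor 3.7 (iii) p.88] -/
def obsEdgePf : ∀ (a : SubVertex {a : Cor37Vertex | a.InDaggerLe 2}), logObsI.{u} a → ℕ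
  | ⟨.box, _⟩, ⟨true⟩ => 0
  | ⟨.box, _⟩, ⟨false⟩ => 1
  | ⟨.first _, _⟩, i => PEmpty.elim i
  | ⟨.space, _⟩, i => PEmpty.elim i
  | ⟨.galois, _⟩, i => PEmpty.elim i
  | ⟨.ref, _⟩, i => PEmpty.elim i

/-- `1` on the edge `λ^{×pf}`, `0` on every other edge of `Γ⃗_{𝒟†_{≤3}}`.
[cite: MochizukiAbsTopIII2015, Cor 3.7 (iii) p.88] -/
def edgePf : ∀ {a b : logObsShape.{u}.Vertex}, (a ⟶ b) → ℕ
  | .base _, .base _, _ => 0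
  | .base a, .obs, i => obsEdgePf a i
  | .obs, .base _, j => PEmpty.elim j
  | .obs, .obs, e => PEmpty.elim e

/-- The number of `λ^{×pf}`-edges of a path (structural recursion).
[cite: MochizukiAbsTopIII2015, Cor 3.7 (iii) p.88] -/
def pfNum {a : logObsShape.{u}.Vertex} : ∀ {b : logObsShape.{u}.Vertex}, Path a b → ℕ
  | _, .nil => 0
  | _, .cons p e => pfNum p + edgePf e

/-- [cite: MochizukiAbsTopIII2015, Cor 3.7 (iii) p.88] -/
@[simp] theorem pfNum_nil (a : logObsShape.{u}.Vertex) : pfNum (Path.nil : Path a a) = 0 := rfl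

/-- [cite: MochizukiAbsTopIII2015, Cor 3.7 (iii) p.88] -/
@[simp] theorem pfNum_cons {a b c : logObsShape.{u}.Vertex} (p : Path a b) (e : b ⟶ c) :
    pfNum (p.cons e) = pfNum p + edgePf e := rfl

/-- [cite: MochizukiAbsTopIII2015, Cor 3.7 (iii) p.88] -/
@[simp] theorem edgePf_eLamTimes : edgePf eLamTimes.{u} = 0 := rfl

/-- [cite: MochizukiAbsTopIII2015, Cor 3.7 (iii) p.88] -/
@[simp] theorem edgePf_eLamPf : edgePf eLamPf.{u} = 1 := rfl

/-- `pfNum` is additive under composition of paths. [cite: MochizukiAbsTopIII2015, Cor 3.7 (iii) p.88] -/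
theorem pfNum_comp {a b : logObsShape.{u}.Vertex} (r : Path a b) :
    ∀ {c : logObsShape.{u}.Vertex} (p : Path b c), pfNum (r.comp p) = pfNum r + pfNum p
  | _, .nil => rfl
  | _, .cons p e => by rw [Path.comp_cons, pfNum_cons, pfNum_cons, pfNum_comp r p, Nat.add_assoc]

/-- A path not ending at `𝒩` contains no `λ^{×pf}`-edge. [cite: MochizukiAbsTopIII2015, Cor 3.7 (iii) p.88] -/
theorem pfNum_eq_zero_of_ne_lvObs {a : logObsShape.{u}.Vertex} :
    ∀ {b : logObsShape.{u}.Vertex} (p : Path a b), b ≠ lvObs.{u} → pfNum p = 0 := by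
  intro b p
  induction p with
  | nil => intro; rfl
  | cons p e ih =>
    rename_i c d
    intro hd
    cases d with
    | obs => exact absurd rfl hd
    | base d =>
      cases c with
      | obs => exact (PEmpty.elim e : _)
      | base c =>
        rw [pfNum_cons, ih (fun h => by cases h)]
        rfl

/-- The value of `edgePf` on an observation edge out of `□` determines the edge.
[cite: MochizukiAbsTopIII2015, Cor 3.7 (iii) p.88] -/
theorem edgePf_up (b : Bool) :
    edgePf (a := lvBox.{u}) (b := lvObs.{u}) (ULift.up b) = if b then 0 else 1 := by
  cases b <;> rfl

end Paths

end BiAnabelianSetting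

end Literature.AnabelianGeometry.AbsoluteAnabelian.AbsTopIII
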